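import Literature.RingTheory.FormalGroups.PadicLogTypeSeriesNsmul
import Literature.NumberTheory.PAdicHodge.BdRPlusLogOneAdd
import HarnessLib

/-!
# `φ·log(1+y) = p·log(1+y)` for Frobenius-multiplicative elements (Teichmüller lifts), `p`-adically

Topic `Literature/RingTheory/FormalGroups`; namespace `Literature.RingTheory.FormalGroups.PadicLogSeries`. THEOREMS ONLY (no
definition, no named fact, no instance, no `sorry`). The multiplicative instance of the additivity machinery
(`PadicLogTypeSeriesAdd`, `PadicLogTypeSeriesNsmul`): numerators `b_m = (−1)^{m+1}` (`b_0 = 0`), series `log(1+X)` (Mathlib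
`PowerSeries.log`), group law `X₀ + X₁ + X₀X₁` (tree `LogSeries.log_subst_mulOneAdd`).

* §7 `log_subst_map_mulOneAdd`, `algebraMap_logNumerator_eq` — the hypotheses `hfG`, `hbf` of the additivity file for `log(1+X)`;
* §8 ★★★ `adicCompletionMap_logSum_log_eq_of_frobenius` — for a ring endomorphism `φ` fixing `ι(ℤ_p)` and a `p`-nilpotent `y` with
  `φ(1+y) = (1+y)ᵖ`: **`φ·Λ^{log}_N(y) = p·Λ^{log}_N(y)`** in `B^_(p)` (EXACT tower `s k = (1+y)ᵏ − 1`). In `A_max` with `1 + y = [x]`,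
  `x ∈ 1 + 𝔪♭`, this is `φ·log[x] = p·log[x]`: the Teichmüller logarithms lie in `(B⁺_crys)^{φ=p}` — brick B6 of the φ-road of line
  `kato_lever` (crux K★ `stmt-BirchSwinnertonDyer-22226`, memo `Lines/kato-lever-K2-phi-road.md`); the tree's `BmaxPlusLog.frobBmaxPlus_tBmax`
  (`φt = pt`) is the case `x = ε`. Infrastructure only: BSD / K★ are not proved by any of this.

## References
* J.-M. Fontaine, *Le corps des périodes p-adiques*, Astérisque 223 (1994), Exp. II §1.5.4. [FontaineAsterisque223III]
* J.-M. Fontaine, Y. Ouyang, *Theory of p-adic Galois representations*, §6.1. [FontaineOuyang2022]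
-/

noncomputable section

open Finset

namespace Literature.RingTheory.FormalGroups

namespace PadicLogSeries

open Literature.AlgebraicGeometry.Resolution
open MvPowerSeries (truncTotal)

variable {p : ℕ} [hp : Fact p.Prime]

universe u

variable {B : Type u} [CommRing B] [IsDomain B] [CharZero B] (ι : ℤ_[p] →+* B)

/-! ## §7 The logarithm `log(1 + y)`: numerators `(−1)^{m+1}` and the multiplicative formal group law -/

/-- The multiplicative group law `X₀ + X₁ + X₀X₁` as an integer polynomial has total degree `≤ 2`. [folklore] -/
private theorem totalDegree_mulOneAdd_le :
    (MvPolynomial.X 0 + MvPolynomial.X 1 + MvPolynomial.X 0 * MvPolynomial.X 1 : MvPolynomial (Fin 2) ℤ).totalDegree ≤ 2 := by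
  refine (MvPolynomial.totalDegree_add _ _).trans (max_le ((MvPolynomial.totalDegree_add _ _).trans (max_le ?_ ?_)) ?_)
  · exact (MvPolynomial.totalDegree_X (R := ℤ) (0 : Fin 2)).le.trans (by norm_num)
  · exact (MvPolynomial.totalDegree_X (R := ℤ) (1 : Fin 2)).le.trans (by norm_num)
  · exact (MvPolynomial.totalDegree_mul _ _).trans (by rw [MvPolynomial.totalDegree_X, MvPolynomial.totalDegree_X])

/-- **The functional equation of `log(1+X)` along `X₀ + X₁ + X₀X₁`** in the form consumed by `PadicLogTypeSeriesAdd`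
(integer group law, rational series; tree `LogSeries.log_subst_mulOneAdd`). [cite: FontaineAsterisque223III, Exp. II §1.5.4] -/
theorem log_subst_map_mulOneAdd :
    (PowerSeries.log ℚ).subst (MvPowerSeries.map (Int.castRingHom ℚ)
        ((MvPolynomial.X 0 + MvPolynomial.X 1 + MvPolynomial.X 0 * MvPolynomial.X 1 : MvPolynomial (Fin 2) ℤ) :
          MvPowerSeries (Fin 2) ℤ)) =
      (PowerSeries.log ℚ).subst (MvPowerSeries.X 0 : MvPowerSeries (Fin 2) ℚ) +
        (PowerSeries.log ℚ).subst (MvPowerSeries.X 1 : MvPowerSeries (Fin 2) ℚ) := by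
  have h : MvPowerSeries.map (Int.castRingHom ℚ)
      ((MvPolynomial.X 0 + MvPolynomial.X 1 + MvPolynomial.X 0 * MvPolynomial.X 1 : MvPolynomial (Fin 2) ℤ) :
        MvPowerSeries (Fin 2) ℤ) =
      (MvPowerSeries.X 0 + MvPowerSeries.X 1 + MvPowerSeries.X 0 * MvPowerSeries.X 1 : MvPowerSeries (Fin 2) ℚ) := by
    simp only [MvPolynomial.coe_add, MvPolynomial.coe_mul, MvPolynomial.coe_X, map_add, map_mul, MvPowerSeries.map_X]
  rw [h]
  exact Literature.NumberTheory.PAdicHodge.LogSeries.log_subst_mulOneAdd ℚ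

omit [IsDomain B] [CharZero B] in
/-- **The numerators of `log(1+X)`**: with `b_m = (−1)^{m+1}` (`b_0 = 0`), `ι(b_m) = m · coeff_m log(1+X)` in any field over `B`.
[cite: FontaineAsterisque223III, Exp. II §1.5.4] -/
theorem algebraMap_logNumerator_eq (K : Type u) [Field K] [Algebra B K] [CharZero K] [Algebra ℚ K] (m : ℕ) :
    algebraMap B K (ι (if m = 0 then 0 else (-1) ^ (m + 1))) = (m : K) * algebraMap ℚ K (PowerSeries.coeff m (PowerSeries.log ℚ)) := by
  rw [PowerSeries.coeff_log]
  rcases eq_or_ne m 0 with rfl | hm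
  · simp
  · rw [if_neg hm, if_neg hm, Algebra.algebraMap_self, RingHom.id_apply, map_div₀, map_pow, map_neg, map_one, map_natCast,
      mul_div_cancel₀ _ (Nat.cast_ne_zero.2 hm : (m : K) ≠ 0), map_pow, map_neg, map_one, map_pow, map_neg, map_one]

/-! ## §8 Frobenius on the logarithm of a multiplicative element: `φ·Λ^{log}(y) = p·Λ^{log}(y)` when `φ(1+y) = (1+y)ᵖ` -/

section Frobenius

variable (φ : B →+* B)

/-- ★★★ **`φ·log(1+y) = p·log(1+y)` in `B^_(p)`** for a ring endomorphism `φ` fixing `ι(ℤ_p)` and a `p`-nilpotent `y` (`y^N = p z`) with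
`φ(1 + y) = (1 + y)ᵖ` — e.g. `1 + y = [x]` a Teichmüller lift in `𝔸_inf` (`φ[x] = [x]ᵖ`), where `Λ^{log}([x] − 1)` is (a `p^N`-multiple of)
Fontaine's `log[x] ∈ (B⁺_crys)^{φ=p}`: along the EXACT iterated-multiplication tower `s k = (1+y)ᵏ − 1` (`s (k+1) = s k + y + s k·y`) the
additivity of `Λ^{log}` gives `Λ(s p) = p·Λ(y)`, and `φ` acts through the arguments. [cite: FontaineAsterisque223III, Exp. II §1.5.4]
[cite: FontaineOuyang2022, §6.1] -/
theorem adicCompletionMap_logSum_log_eq_of_frobenius (hφι : φ.comp ι = ι) {N : ℕ} (hN : 1 ≤ N) {y z : B}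
    (hyz : y ^ N = (p : B) * z) (hφ : φ (1 + y) = (1 + y) ^ p) :
    adicCompletionMap _ _ φ (map_span_natCast_le φ)
        (logSum ι (fun m => if m = 0 then 0 else (-1) ^ (m + 1)) N y z) =
      (p : AdicCompletion (Ideal.span {(p : B)}) B) * logSum ι (fun m => if m = 0 then 0 else (-1) ^ (m + 1)) N y z := by
  set bL : ℕ → ℤ_[p] := fun m => if m = 0 then 0 else (-1) ^ (m + 1) with hbL
  haveI : CharZero (FractionRing B) := charZero_of_injective_algebraMap (IsFractionRing.injective B (FractionRing B))
  -- the tower `s k = (1+y)^k - 1` with witnesses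
  have hsy : ∀ k : ℕ, ∃ c : B, (1 + y) ^ k - 1 = y * c := fun k => by
    induction k with
    | zero => exact ⟨0, by ring⟩
    | succ k ih =>
      obtain ⟨c, hc⟩ := ih
      exact ⟨c + 1 + y * c, by rw [pow_succ]; linear_combination (1 + y) * hc⟩
  choose c hc using hsy
  have hszs : ∀ k, ((1 + y) ^ k - 1) ^ N = (p : B) * (z * c k ^ N) := fun k => by
    rw [hc k, mul_pow, hyz, mul_assoc]
  have hstep : ∀ k j : ℕ, ∃ D₀ : ℕ, ∀ D, D₀ ≤ D →
      ((1 + y) ^ (k + 1) - 1) - MvPolynomial.aeval (![(1 + y) ^ k - 1, y] : Fin 2 → B)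
        (truncTotal (D + 1) ((MvPolynomial.X 0 + MvPolynomial.X 1 + MvPolynomial.X 0 * MvPolynomial.X 1 :
          MvPolynomial (Fin 2) ℤ) : MvPowerSeries (Fin 2) ℤ)) ∈ Ideal.span {(p : B)} ^ j := by
    intro k j
    refine ⟨2, fun D hD => ?_⟩
    have htr : truncTotal (D + 1) ((MvPolynomial.X 0 + MvPolynomial.X 1 + MvPolynomial.X 0 * MvPolynomial.X 1 :
        MvPolynomial (Fin 2) ℤ) : MvPowerSeries (Fin 2) ℤ) =
        (MvPolynomial.X 0 + MvPolynomial.X 1 + MvPolynomial.X 0 * MvPolynomial.X 1 : MvPolynomial (Fin 2) ℤ) :=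
      (MvPowerSeries.truncTotal_coe_eq_self_iff _ (Nat.succ_ne_zero D)).2 (totalDegree_mulOneAdd_le.trans_lt (by omega))
    rw [htr]
    simp only [map_add, map_mul, MvPolynomial.aeval_X, Matrix.cons_val_zero, Matrix.cons_val_one]
    rw [show (1 + y) ^ (k + 1) - 1 - ((1 + y) ^ k - 1 + y + ((1 + y) ^ k - 1) * y) = 0 by ring]
    exact zero_mem _
  have htower := logSum_eq_nsmul_of_tower ι bL (PowerSeries.log ℚ) (algebraMap_logNumerator_eq ι (FractionRing B))
    (G := ((MvPolynomial.X 0 + MvPolynomial.X 1 + MvPolynomial.X 0 * MvPolynomial.X 1 : MvPolynomial (Fin 2) ℤ) :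
      MvPowerSeries (Fin 2) ℤ))
    (by simp [MvPolynomial.coe_add, MvPolynomial.coe_mul, MvPolynomial.coe_X]) log_subst_map_mulOneAdd hN hyz
    (fun k => (1 + y) ^ k - 1) (fun k => z * c k ^ N) (by simp) hszs hstep p
  -- `φ` acts through the arguments, and `φ y = (1+y)^p - 1`
  have hφy : φ y = (1 + y) ^ p - 1 := by
    have h := hφ; rw [map_add, map_one] at h; linear_combination h
  have hφz : (φ y) ^ N = (p : B) * φ z := by rw [← map_pow, hyz, map_mul, map_natCast]
  rw [adicCompletionMap_logSum, hφι, logSum_congr_witness ι bL hφz (by rw [hφy]; exact hszs p), hφy, htower]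

end Frobenius

end PadicLogSeries

end Literature.RingTheory.FormalGroups

end
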